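import Literature.Topology.FourManifolds.SliceCharts
import Literature.Topology.FourManifolds.MorseProofs
import Literature.Topology.FourManifolds.HCobordismHandles
import Mathlib.Analysis.Calculus.InverseFunctionTheorem.ContDiff
import Mathlib.Analysis.Normed.Ring.Units
import Mathlib.LinearAlgebra.FiniteDimensional.Lemmas
import HarnessLib

/-!
# Regular level sets of smooth functions; the levels of a Morse function on a cobordism

Topic `Literature/Topology/FourManifolds` (rung v1 of the DAG of the fact item
`provefact-Literature.nonempty_homeomorph_of_isHCobordant_four`, see `HCobordismFreedman.lean`, shared
with rung K2 of `provefact-Literature.corkDecomposition`, see `HCobordismMiddleLevel.lean`: both start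
from a regular level `f⁻¹(c)` of a Morse function on a 5-dimensional h-cobordism as a closed
smooth 4-manifold).

**The regular value theorem, real-valued case, at interior points** (Hirsch, *Differential
Topology* (1976), Ch. 1, §3, Thm. 3.2: *if `y ∈ f(M)` is a regular value of the `Cʳ` map
`f : M → N` then `f⁻¹(y)` is a `Cʳ` submanifold of `M`*, "again the theorem follows from the
inverse function theorem"; for `∂`-manifolds Thm. 4.1, ibid. §4: `f⁻¹(y)` is a neat submanifold
when `y` is regular for `f` and `f|∂M` — here the level does not meet `∂M` at all; Milnor,
*Lectures on the h-cobordism theorem* (1965), Def. 3.1 and §3: the levels of a Morse function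
on a cobordism). Let `M` be a `C^∞` manifold modelled on a model with corners `I` on `ℝⁿ⁺¹`
(`𝓡 (n + 1)`, or `𝓡∂ (n + 1)` for manifolds with boundary), `f : M → ℝ` smooth and `a ∈ ℝ`
such that every point of the level `f⁻¹(a)` is an interior point of `M` and a regular point of
`f` (`Literature.IsRegularLevel I f a`). Then `f⁻¹(a)` is a smooth `n`-manifold without boundary,
closed in `M` (compact if `M` is), and its inclusion into `M` is a smooth embedding.

## Contents

* `Literature.Topology.FourManifolds.exists_continuousLinearEquiv_snd_eq`: a nonzero linear form `L` on `ℝⁿ⁺¹` is the last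
  coordinate of a linear isomorphism `T : ℝⁿ⁺¹ ≅ ℝⁿ × ℝ`.
* `Literature.Topology.FourManifolds.exists_openPartialHomeomorph_contDiffOn_symm`: the inverse function theorem on a normed
  space, packaged as an `OpenPartialHomeomorph` with `Cᵐ` inverse whose source lies in a
  prescribed open set (Mathlib's `ContDiffAt.toOpenPartialHomeomorph` restricted to the open
  set where the derivative stays invertible).
* `Literature.SliceModel I`: the (technical, `Prop`-valued) class of models with corners `I` on `ℝⁿ⁺¹`
  whose interior meets the hyperplane `{last coordinate = 0}`; instances for `𝓡 (n + 1)` and,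
  for `n ≥ 1`, `𝓡∂ (n + 1)`. (Mathlib's normal form for immersions, `Manifold.IsImmersionAt`,
  is linear, not affine, so a slice chart must carry the slice into a *linear* hyperplane
  meeting the interior of the model. For `𝓡∂ 1` the hyperplane `{y 0 = 0}` *is* the boundary
  of the half-line, so there is no instance: levels of functions on `1`-manifolds with boundary
  are not covered.) A class rather than a hypothesis, so that the instances on
  `Literature.RegularLevel h` below are found by instance resolution for both models.
* `Literature.Topology.FourManifolds.exists_sliceChart`: **straightening a smooth function at an interior regular point**
  — if `f` is smooth, `z` is an interior point and `df_z ≠ 0` then some chart `ψ` of the maximal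
  atlas around `z`, valued in the interior of the model, has last coordinate `f - f z`
  (inverse function theorem applied to `y ↦ (π (T y) + const, f φ⁻¹ y - f z)` in the chart `φ`
  at `z`, `T` as above for `L = d(f ∘ φ⁻¹)`; Hirsch, proof of Thm. 3.2).
* `Literature.IsRegularLevel I f a`, `Literature.Topology.FourManifolds.IsRegularLevel.sliceChartFamily`: the slice charts along a
  regular level (`SliceCharts.lean`), and the type `Literature.RegularLevel h` (`h : IsRegularLevel I f a`)
  — the subtype `f⁻¹(a)` — with its instances `ChartedSpace (𝔼 n)`, `IsManifold (𝓡 n) ∞`,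
  `T2Space`, `SecondCountableTopology`, `CompactSpace` (for compact `M`), the inclusion
  `Literature.RegularLevel.incl h : RegularLevel h → M` and `Literature.Topology.FourManifolds.RegularLevel.isSmoothEmbedding_incl`,
  `Literature.Topology.FourManifolds.RegularLevel.range_incl` (`= f ⁻¹' {a}`),
  `Literature.Topology.FourManifolds.IsRegularLevel.exists_isSmoothEmbedding_range_eq` (existential packaging).
* `Literature.Topology.FourManifolds.Cobordism.IsMorseFunction.isRegularLevel`,
  `Literature.Topology.FourManifolds.Cobordism.IsMorseFunction.exists_isSmoothEmbedding_range_eq`: for a Morse function `f` on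
  a cobordism `(W; M, N)` of `n`-manifolds, `n ≥ 1` (`Handles.lean`, Milnor 1965, Def. 3.1) and a
  regular value `a ∈ (0, 1)`, the level `f⁻¹(a)` is a closed smooth `n`-manifold smoothly
  embedded in `W` (the form in which `HCobordismMiddleLevel.lean` consumes the middle level).
* `Literature.Topology.FourManifolds.IsHCobordant.exists_middleLevel_of_two_three`: rung K1 of the h-cobordism DAGs
  (`Literature.Topology.FourManifolds.exists_isMorseFunction_two_three_of_isHCobordism`, `HCobordismHandles.lean`: a Morse
  function with only index-`2` critical points below `1/2` and index-`3` ones above) yields the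
  middle level `f⁻¹(1/2)` of a simply connected `5`-dimensional h-cobordism as a closed smooth
  `4`-manifold smoothly embedded in `W` (Kirby 1989, Ch. X, p. 55; Freedman–Quinn 1990, proof of
  Thm. 7.1D, p. 85) — the starting datum of rung v2 (Casson's constructions in the middle level,
  `HCobordismFreedman.lean`) and the manifold half of K1′ (`HCobordismMiddleLevel.lean`).

## References

* M. W. Hirsch, *Differential Topology*, GTM 33, Springer (1976), Ch. 1: §2 (submanifold
  charts, p. 14), §3 Thms. 3.1–3.2 (pp. 21–23), §4 Thm. 4.1 (p. 30). [HirschDT1976]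
* J. Milnor, *Lectures on the h-cobordism theorem*, Princeton Univ. Press (1965), Def. 3.1, §3.
  [MilnorHCobordism1965]
* J. M. Lee, *Introduction to Smooth Manifolds*, 2nd ed., GTM 218 (2013), Cor. 5.14 (regular
  level set theorem). [LeeSmoothManifolds2013]
* R. C. Kirby, *The Topology of 4-Manifolds*, LNM 1374, Springer (1989), Ch. X, proof of Thm. 1,
  p. 55 (the middle level `M_{1/2} = f⁻¹(1/2)`). [Kirby1989]
* M. H. Freedman, F. Quinn, *Topology of 4-manifolds*, Princeton Math. Series 39 (1990), §7.1,
  proof of Thm. 7.1D, p. 85 (the level `N` between the 2- and 3-handles). [FreedmanQuinnPMS1990]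
-/

open scoped Manifold ContDiff Topology
open Set Function Module Filter

noncomputable section

universe u

namespace Literature.Topology.FourManifolds

/-- Local notation: `𝔼 n` is the model Euclidean space `EuclideanSpace ℝ (Fin n)`. -/
local notation "𝔼 " n:arg => EuclideanSpace ℝ (Fin n)

/-! ### Linear algebra: a nonzero linear form is a coordinate -/

/-- A nonzero linear form `L` on `ℝⁿ⁺¹` is the last coordinate of a linear isomorphism
`T : ℝⁿ⁺¹ ≅ ℝⁿ × ℝ`, i.e. `(T y).2 = L y` (complete a basis of `ker L ≅ ℝⁿ`). [folklore] -/
theorem exists_continuousLinearEquiv_snd_eq {n : ℕ} (L : 𝔼 (n + 1) →L[ℝ] ℝ) (hL : L ≠ 0) :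
    ∃ T : 𝔼 (n + 1) ≃L[ℝ] (𝔼 n × ℝ), ∀ y, (T y).2 = L y := by
  -- a vector on which `L` does not vanish
  obtain ⟨v, hv⟩ : ∃ v, L v ≠ 0 := by
    by_contra! h
    exact hL (ContinuousLinearMap.ext h)
  -- `L` is onto `ℝ`
  have hrange : LinearMap.range (L : 𝔼 (n + 1) →ₗ[ℝ] ℝ) = ⊤ := by
    rw [eq_top_iff]
    rintro c -
    refine ⟨(c / L v) • v, ?_⟩
    simp [div_mul_cancel₀ c hv]
  -- so its kernel has dimension `n`
  have hfinK : finrank ℝ (LinearMap.ker (L : 𝔼 (n + 1) →ₗ[ℝ] ℝ)) = n := by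
    have h := LinearMap.finrank_range_add_finrank_ker (L : 𝔼 (n + 1) →ₗ[ℝ] ℝ)
    rw [hrange, finrank_top, finrank_self, finrank_euclideanSpace_fin] at h
    omega
  set K : Submodule ℝ (𝔼 (n + 1)) := LinearMap.ker (L : 𝔼 (n + 1) →ₗ[ℝ] ℝ) with hK
  -- identify the kernel with `ℝⁿ` and retract `ℝⁿ⁺¹` onto the kernel
  let e : K ≃ₗ[ℝ] 𝔼 n := LinearEquiv.ofFinrankEq K (𝔼 n) (by rw [hfinK, finrank_euclideanSpace_fin])
  obtain ⟨g, hg⟩ := LinearMap.exists_leftInverse_of_injective K.subtype (by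
    rw [Submodule.ker_subtype])
  let T₀ : 𝔼 (n + 1) →ₗ[ℝ] (𝔼 n × ℝ) := ((e : K →ₗ[ℝ] 𝔼 n) ∘ₗ g).prod (L : 𝔼 (n + 1) →ₗ[ℝ] ℝ)
  have hT₀ : Injective T₀ := by
    rw [← LinearMap.ker_eq_bot, LinearMap.ker_eq_bot']
    intro y hy
    have hy2 : L y = 0 := congrArg Prod.snd hy
    have hy1 : e (g y) = 0 := congrArg Prod.fst hy
    have hyK : y ∈ K := hy2
    have hgy : g y = ⟨y, hyK⟩ := by
      simpa using LinearMap.congr_fun hg ⟨y, hyK⟩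
    rw [hgy, LinearEquiv.map_eq_zero_iff] at hy1
    exact congrArg Subtype.val hy1
  have hdim : finrank ℝ (𝔼 (n + 1)) = finrank ℝ (𝔼 n × ℝ) := by
    simp [finrank_prod]
  exact ⟨(LinearMap.linearEquivOfInjective T₀ hT₀ hdim).toContinuousLinearEquiv, fun y => rfl⟩

/-! ### The inverse function theorem, packaged -/

/-- **Inverse function theorem, packaged.** A map `Θ` which is `Cᵐ`, `m ≥ 1`, on an open set
`O ∋ y₀` of a complete normed space and has an invertible derivative `T` at `y₀` restricts to an
open partial homeomorphism `G` (as functions `G = Θ` everywhere) with `y₀ ∈ G.source ⊆ O`, `Cᵐ`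
on its source and with `Cᵐ` inverse on its target: Mathlib's `ContDiffAt.toOpenPartialHomeomorph`,
restricted to the open subset of `O` where the derivative stays invertible so that the inverse is
`Cᵐ` at *every* point of the target (`OpenPartialHomeomorph.contDiffAt_symm`); the same
restriction argument is inlined in the proof of
`Literature.Topology.FourManifolds.isLocalDiffeomorphAt_of_hasFDerivAt_writtenInExtChartAt` (`InverseFunctionTheorem.lean`,
boundaryless manifolds), here it is needed on the model vector space. [folklore] -/
theorem exists_openPartialHomeomorph_contDiffOn_symm {E F : Type*} [NormedAddCommGroup E]
    [NormedSpace ℝ E] [CompleteSpace E] [NormedAddCommGroup F] [NormedSpace ℝ F]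
    {Θ : E → F} {O : Set E} (hO : IsOpen O) {y₀ : E} (hy₀ : y₀ ∈ O) {m : WithTop ℕ∞}
    (hm : 1 ≤ m) (hΘ : ContDiffOn ℝ m Θ O) (T : E ≃L[ℝ] F)
    (hT : HasFDerivAt Θ (T : E →L[ℝ] F) y₀) :
    ∃ G : OpenPartialHomeomorph E F, ⇑G = Θ ∧ y₀ ∈ G.source ∧ G.source ⊆ O ∧
      ContDiffOn ℝ m G G.source ∧ ContDiffOn ℝ m G.symm G.target := by
  have hm0 : m ≠ 0 := by
    rintro rfl
    exact not_lt.2 hm zero_lt_one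
  -- the open subset `O' ⊆ O` where the derivative of `Θ` is invertible
  set A : E → E →L[ℝ] E := fun e => (T.symm : F →L[ℝ] E).comp (fderiv ℝ Θ e) with hA
  have hAcont : ContinuousOn A O :=
    continuousOn_const.clm_comp (hΘ.continuousOn_fderiv_of_isOpen hO hm)
  set O' : Set E := O ∩ A ⁻¹' {u | IsUnit u} with hO'
  have hO'open : IsOpen O' := hAcont.isOpen_inter_preimage hO Units.isOpen
  have hAy : A y₀ = 1 := by
    rw [hA]
    dsimp only
    rw [hT.fderiv]
    ext v
    simp
  have hyO' : y₀ ∈ O' := ⟨hy₀, by rw [mem_preimage, mem_setOf_eq, hAy]; exact isUnit_one⟩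
  have hΘAt : ∀ e ∈ O', ContDiffAt ℝ m Θ e := fun e he => hΘ.contDiffAt (hO.mem_nhds he.1)
  have hderiv : ∀ e ∈ O', ∃ Te : E ≃L[ℝ] F, HasFDerivAt Θ (Te : E →L[ℝ] F) e := by
    intro e he
    have hunit : IsUnit (A e) := he.2
    refine ⟨(ContinuousLinearEquiv.unitsEquiv ℝ E hunit.unit).trans T, ?_⟩
    have hd : HasFDerivAt Θ (fderiv ℝ Θ e) e := ((hΘAt e he).differentiableAt hm0).hasFDerivAt
    convert hd using 1
    ext v
    simp [hA]
  set G : OpenPartialHomeomorph E F :=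
    ((hΘAt _ hyO').toOpenPartialHomeomorph Θ hT hm0).restrOpen O' hO'open with hGdef
  have hGsource : G.source ⊆ O' := fun e he => he.2
  refine ⟨G, rfl, ⟨(hΘAt _ hyO').mem_toOpenPartialHomeomorph_source hT hm0, hyO'⟩,
    fun e he => (hGsource he).1, hΘ.mono fun e he => (hGsource he).1, ?_⟩
  intro b hb
  have hb' : G.symm b ∈ O' := hGsource (G.map_target hb)
  obtain ⟨Te, hTe⟩ := hderiv _ hb'
  exact (G.contDiffAt_symm hb hTe (hΘAt _ hb')).contDiffWithinAt

/-! ### Models whose interior meets the slice hyperplane -/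

section SliceModel

variable {n : ℕ} {H : Type*} [TopologicalSpace H]

/-- A model with corners `I` on `ℝⁿ⁺¹` is a *slice model* if the interior of `range I` meets
the hyperplane `{y | y n = 0} = snocEquiv n (ℝⁿ × {0})`. This technical condition (satisfied
by `𝓡 (n + 1)` and, for `n ≥ 1`, by `𝓡∂ (n + 1)`) is what makes slice charts
(`Literature.Topology.FourManifolds.SliceChartFamily`) at interior points possible: Mathlib's normal form for immersions
(`Manifold.IsImmersionAt`) is *linear*, so a slice chart must carry the slice into a linear
hyperplane that meets the interior of the model. [folklore] -/
class SliceModel (I : ModelWithCorners ℝ (𝔼 (n + 1)) H) : Prop where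
  /-- Some point of the slice hyperplane lies in the interior of the model. -/
  exists_snocEquiv_mem_interior : ∃ c : 𝔼 n, snocEquiv n (c, 0) ∈ interior (range I)

/-- The boundaryless model `𝓡 (n + 1)` is a slice model (its range is everything). [folklore] -/
instance sliceModel_euclidean (n : ℕ) : SliceModel (𝓡 (n + 1)) :=
  ⟨⟨0, by simp⟩⟩

/-- The half-space model `𝓡∂ (n + 1)`, `n ≥ 1`, is a slice model: the interior of its range is
`{y | 0 < y 0}` (`interior_range_modelWithCornersEuclideanHalfSpace`), which contains
`snocEquiv n (e₀, 0)`, `e₀ = (1, 0, …, 0) ∈ ℝⁿ`. (False for `n = 0`.) [folklore] -/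
instance sliceModel_euclideanHalfSpace (n : ℕ) [NeZero n] : SliceModel (𝓡∂ (n + 1)) := by
  refine ⟨⟨EuclideanSpace.single 0 1, ?_⟩⟩
  rw [interior_range_modelWithCornersEuclideanHalfSpace]
  show (0 : ℝ) < snocEquiv n (EuclideanSpace.single 0 1, 0) 0
  rw [snocEquiv_apply_zero]
  simp

end SliceModel

/-! ### Straightening a smooth function at an interior regular point -/

section Straightening

variable {n : ℕ} {H : Type*} [TopologicalSpace H] {I : ModelWithCorners ℝ (𝔼 (n + 1)) H}
  {M : Type u} [TopologicalSpace M] [ChartedSpace H M] [IsManifold I ∞ M]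

/-- **Straightening a smooth function at an interior regular point.** Let `f : M → ℝ` be
smooth on a `C^∞` manifold `M` modelled on a slice model `I` on `ℝⁿ⁺¹`, and let `z` be an
interior point of `M` which is not a critical point of `f`. Then there is a chart `ψ` of the
maximal `C^∞` atlas of `M` around `z`, valued in the interior of the model, whose last
coordinate is `f - f z`: `I (ψ q) n = f q - f z` on `ψ.source`. Proof: in the chart `φ` at `z`
write `g = f ∘ φ⁻¹`, pick `T : ℝⁿ⁺¹ ≅ ℝⁿ × ℝ` with last coordinate `dg(φ z) ≠ 0`
(`exists_continuousLinearEquiv_snd_eq`); the map `Θ y = snocEquiv (π₁ (T y) - π₁ (T (φ z)) + c,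
g y - f z)` has derivative `snocEquiv ∘ T` at `φ z`, so is a local diffeomorphism there (inverse
function theorem), and `ψ = (I⁻¹ Θ I) ∘ φ` (`OpenPartialHomeomorph.conjModel`) is the chart.
This is the local content of the regular value theorem (Hirsch, *Differential Topology* (1976),
Ch. 1, §3, proof of Thm. 3.2: "the theorem follows from the inverse function theorem").
[cite: HirschDT1976, Ch. 1 §3, Thm. 3.2 (proof)] -/
theorem exists_sliceChart [SliceModel I] {f : M → ℝ} (hf : ContMDiff I 𝓘(ℝ, ℝ) ∞ f) {z : M}
    (hz : I.IsInteriorPoint z) (hz' : ¬ IsMCriticalPt I f z) :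
    ∃ ψ : OpenPartialHomeomorph M H, ψ ∈ IsManifold.maximalAtlas I ∞ M ∧ z ∈ ψ.source ∧
      (∀ q ∈ ψ.source, I (ψ q) (Fin.last n) = f q - f z) ∧
      ∀ q ∈ ψ.source, I (ψ q) ∈ interior (range I) := by
  -- the chart at `z`, and `f` read in it
  set φ := chartAt H z with hφ
  set y₀ : 𝔼 (n + 1) := extChartAt I z z with hy₀
  have hy₀' : y₀ = I (φ z) := rfl
  set g : 𝔼 (n + 1) → ℝ := f ∘ (extChartAt I z).symm with hg
  -- the open set `O ∋ y₀` (inside the interior of the model) on which `g` is smooth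
  set O : Set (𝔼 (n + 1)) := I.symm ⁻¹' φ.target ∩ interior (range I) with hO
  have hOopen : IsOpen O := (φ.open_target.preimage I.continuous_symm).inter isOpen_interior
  have hy₀O : y₀ ∈ O := ⟨by rw [mem_preimage, hy₀', I.left_inv]; exact mem_chart_target H z, hz⟩
  have hOsub : O ⊆ (extChartAt I z).target := by
    rintro y ⟨hy, hy'⟩
    rw [extChartAt_target]
    exact ⟨hy, interior_subset hy'⟩
  have hgO : ContDiffOn ℝ ∞ g O := by
    have h := (contMDiff_iff.1 hf).2 z (f z)
    refine (h.mono ?_).congr ?_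
    · intro y hy
      refine ⟨hOsub hy, ?_⟩
      simp only [mem_preimage, extChartAt_source, chartAt_self_eq,
        OpenPartialHomeomorph.refl_source, mem_univ]
    · intro y _
      simp only [hg, comp_apply, extChartAt_self_apply, modelWithCornersSelf_coe, id_eq]
  -- the derivative `L ≠ 0` of `g` at `y₀`
  have hmd : MDifferentiableAt I 𝓘(ℝ, ℝ) f z := (hf z).mdifferentiableAt (by simp)
  have hL0 : fderivWithin ℝ (writtenInExtChartAt I 𝓘(ℝ, ℝ) z f) (range I) y₀ ≠ 0 := fun h =>
    hz' ((isMCriticalPt_iff_fderivWithin_writtenInExtChartAt_eq_zero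
      (mem_extChartAt_source z) hmd).2 h)
  have hw : writtenInExtChartAt I 𝓘(ℝ, ℝ) z f = g := by
    ext y
    simp [writtenInExtChartAt, hg]
  have hnhds : range I ∈ 𝓝 y₀ := mem_of_superset (isOpen_interior.mem_nhds hz) interior_subset
  set L : 𝔼 (n + 1) →L[ℝ] ℝ := fderiv ℝ g y₀ with hL
  have hL' : L ≠ 0 := by rwa [hw, fderivWithin_of_mem_nhds hnhds] at hL0
  have hgderiv : HasFDerivAt g L y₀ :=
    ((hgO.contDiffAt (hOopen.mem_nhds hy₀O)).differentiableAt (by simp)).hasFDerivAt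
  obtain ⟨T, hT⟩ := exists_continuousLinearEquiv_snd_eq L hL'
  obtain ⟨c, hc⟩ := SliceModel.exists_snocEquiv_mem_interior (I := I)
  -- the straightening map `Θ` and its derivative `snocEquiv ∘ T` at `y₀`
  have hgy₀ : g y₀ = f z := by
    rw [hg, comp_apply, hy₀, extChartAt_to_inv]
  set Θ : 𝔼 (n + 1) → 𝔼 (n + 1) :=
    fun y => snocEquiv n ((T y).1 - (T y₀).1 + c, g y - f z) with hΘ
  have hΘy₀ : Θ y₀ = snocEquiv n (c, 0) := by
    simp only [hΘ, sub_self, zero_add, hgy₀]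
  have hΘO : ContDiffOn ℝ ∞ Θ O := by
    refine (snocEquiv n).contDiff.comp_contDiffOn (ContDiffOn.prodMk ?_ ?_)
    · exact ((contDiff_fst.comp T.contDiff).contDiffOn.sub contDiffOn_const).add
        contDiffOn_const
    · exact hgO.sub contDiffOn_const
  have hΘderiv : HasFDerivAt Θ
      ((T.trans (snocEquiv n) : 𝔼 (n + 1) ≃L[ℝ] 𝔼 (n + 1)) : 𝔼 (n + 1) →L[ℝ] 𝔼 (n + 1)) y₀ := by
    have h1 : HasFDerivAt (fun y => (T y).1 - (T y₀).1 + c)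
        ((ContinuousLinearMap.fst ℝ (𝔼 n) ℝ).comp (T : 𝔼 (n + 1) →L[ℝ] 𝔼 n × ℝ)) y₀ :=
      (((ContinuousLinearMap.fst ℝ (𝔼 n) ℝ).comp
        (T : 𝔼 (n + 1) →L[ℝ] 𝔼 n × ℝ)).hasFDerivAt.sub_const _).add_const _
    have h2 : HasFDerivAt (fun y => g y - f z) L y₀ := hgderiv.sub_const _
    have h3 := (snocEquiv n).hasFDerivAt.comp y₀ (h1.prodMk h2)
    refine h3.congr_fderiv (ContinuousLinearMap.ext fun y => ?_)
    simp only [ContinuousLinearEquiv.coe_coe, ContinuousLinearEquiv.trans_apply,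
      ContinuousLinearMap.coe_comp, comp_apply, ContinuousLinearMap.prod_apply,
      ContinuousLinearMap.coe_fst']
    rw [← hT y]
  -- the inverse function theorem
  obtain ⟨G, hGΘ, hy₀G, hGO, hGsm, hGsm'⟩ :=
    exists_openPartialHomeomorph_contDiffOn_symm hOopen hy₀O (m := ∞) (by simp) hΘO
      (T.trans (snocEquiv n)) hΘderiv
  -- the chart `ψ = (I⁻¹ G I) ∘ φ`
  set K := G.conjModel I with hK
  have hKmem : K ∈ contDiffGroupoid ∞ I :=
    OpenPartialHomeomorph.conjModel_mem_contDiffGroupoid hGsm hGsm'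
  refine ⟨φ ≫ₕ K, ?_, ?_, ?_, ?_⟩
  · exact (contDiffGroupoid ∞ I).trans_mem_maximalAtlas (IsManifold.chart_mem_maximalAtlas z)
      hKmem
  · rw [OpenPartialHomeomorph.trans_source]
    refine ⟨mem_chart_source H z, ?_⟩
    rw [mem_preimage, hK, OpenPartialHomeomorph.mem_conjModel_source, ← hy₀', hGΘ, hΘy₀]
    exact ⟨hz, hy₀G, hc⟩
  · intro q hq
    rw [OpenPartialHomeomorph.trans_source] at hq
    obtain ⟨hq₁, hq₂⟩ := hq
    rw [OpenPartialHomeomorph.coe_trans, comp_apply,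
      OpenPartialHomeomorph.apply_conjModel_of_mem_source hq₂, hGΘ]
    simp only [hΘ, snocEquiv_apply_last, hg, comp_apply]
    have hq₁' : q ∈ (extChartAt I z).source := by rwa [extChartAt_source]
    rw [show I (φ q) = extChartAt I z q from rfl, (extChartAt I z).left_inv hq₁']
  · intro q hq
    rw [OpenPartialHomeomorph.trans_source] at hq
    rw [OpenPartialHomeomorph.coe_trans, comp_apply]
    exact (K.map_source hq.2).1

end Straightening

/-! ### Regular levels -/

section RegularLevel

variable {n : ℕ} {H : Type*} [TopologicalSpace H] (I : ModelWithCorners ℝ (𝔼 (n + 1)) H)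
  {M : Type u} [TopologicalSpace M] [ChartedSpace H M]

/-- `a` is a *regular level* of the smooth function `f : M → ℝ`, lying in the interior: `f` is
`C^∞`, and every point `x` with `f x = a` is an interior point of `M` and a regular (= not a
critical) point of `f` (`Literature.Topology.FourManifolds.IsMCriticalPt`: `df_x = 0`). For a `∂`-manifold this is the
hypothesis of the regular value theorem with the level missing the boundary (Hirsch,
*Differential Topology* (1976), Ch. 1, §3, before Thm. 3.2: regular point, critical point,
regular value; §4, Thm. 4.1). The level may be empty. [cite: HirschDT1976, Ch. 1 §3–§4] -/
structure IsRegularLevel (f : M → ℝ) (a : ℝ) : Prop where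
  /-- `f` is smooth. -/
  contMDiff : ContMDiff I 𝓘(ℝ, ℝ) ∞ f
  /-- The level lies in the interior of `M`. -/
  isInteriorPoint : ∀ ⦃x⦄, f x = a → I.IsInteriorPoint x
  /-- The level contains no critical point of `f`. -/
  not_isMCriticalPt : ∀ ⦃x⦄, f x = a → ¬ IsMCriticalPt I f x

variable {I}

namespace IsRegularLevel

variable {f : M → ℝ} {a : ℝ}

/-- A regular level is closed. [folklore] -/
theorem isClosed_preimage (h : IsRegularLevel I f a) : IsClosed (f ⁻¹' {a}) :=
  isClosed_singleton.preimage h.contMDiff.continuous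

/-- A regular level of a function on a compact manifold is compact. [folklore] -/
theorem isCompact_preimage [CompactSpace M] (h : IsRegularLevel I f a) : IsCompact (f ⁻¹' {a}) :=
  h.isClosed_preimage.isCompact

/-- A regular level lies in the interior. [folklore] -/
theorem preimage_subset_interior (h : IsRegularLevel I f a) : f ⁻¹' {a} ⊆ I.interior M :=
  fun _ hx => h.isInteriorPoint hx

variable [IsManifold I ∞ M] [SliceModel I]

/-- Slice charts along a regular level: at every point of `f⁻¹(a)` there is a chart of the
maximal atlas, valued in the interior of the model, in which `f⁻¹(a)` is the slice
`{last coordinate = 0}` (`exists_sliceChart`, with last coordinate `f - a`).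
[cite: HirschDT1976, Ch. 1 §3, Thm. 3.2 (proof)] -/
theorem exists_sliceChart (h : IsRegularLevel I f a) (p : f ⁻¹' {a}) :
    ∃ ψ : OpenPartialHomeomorph M H, ψ ∈ IsManifold.maximalAtlas I ∞ M ∧ p.1 ∈ ψ.source ∧
      (∀ q ∈ ψ.source, q ∈ f ⁻¹' {a} ↔ I (ψ q) (Fin.last n) = 0) ∧
      ∀ q ∈ ψ.source, I (ψ q) ∈ interior (range I) := by
  obtain ⟨ψ, h1, h2, h3, h4⟩ :=
    Literature.Topology.FourManifolds.exists_sliceChart h.contMDiff (h.isInteriorPoint p.2) (h.not_isMCriticalPt p.2)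
  refine ⟨ψ, h1, h2, fun q hq => ?_, h4⟩
  rw [h3 q hq, sub_eq_zero, mem_preimage, mem_singleton_iff, show f p.1 = a from p.2]

/-- **The slice charts of a regular level** (a choice of one slice chart at each point of
`f⁻¹(a)`), the datum from which `SliceCharts.lean` builds the manifold structure.
[cite: HirschDT1976, Ch. 1 §3, Thm. 3.2] -/
def sliceChartFamily (h : IsRegularLevel I f a) : SliceChartFamily I (f ⁻¹' {a}) where
  chart p := Classical.choose (h.exists_sliceChart p)
  mem_maximalAtlas p := (Classical.choose_spec (h.exists_sliceChart p)).1
  mem_source p := (Classical.choose_spec (h.exists_sliceChart p)).2.1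
  mem_iff p := (Classical.choose_spec (h.exists_sliceChart p)).2.2.1
  mem_interior p := (Classical.choose_spec (h.exists_sliceChart p)).2.2.2

end IsRegularLevel

/-- **The regular level `f⁻¹(a)` as a type**: the subtype `↥(f ⁻¹' {a})` of `M`, recorded
together with the proof `h : IsRegularLevel I f a` so that the smooth structure (which is built
from `h`) can be registered as instances: `ChartedSpace (𝔼 n)`, `IsManifold (𝓡 n) ∞`,
`T2Space`, `SecondCountableTopology`, `CompactSpace`. Hirsch, *Differential Topology* (1976),
Ch. 1, §3, Thm. 3.2 (the regular level surface `f⁻¹(y)` is a submanifold).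
[cite: HirschDT1976, Ch. 1 §3, Thm. 3.2] -/
@[nolint unusedArguments]
def RegularLevel {f : M → ℝ} {a : ℝ} (_h : IsRegularLevel I f a) : Type u := ↥(f ⁻¹' {a})

namespace RegularLevel

variable {f : M → ℝ} {a : ℝ}

/-- The regular level carries the subspace topology. [folklore] -/
instance instTopologicalSpace (h : IsRegularLevel I f a) : TopologicalSpace (RegularLevel h) :=
  instTopologicalSpaceSubtype

/-- The inclusion of the regular level into `M` (the subtype coercion). [folklore] -/
@[reducible]
def incl (h : IsRegularLevel I f a) : RegularLevel h → M := Subtype.val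

/-- The points of `RegularLevel h` lie on the level. [folklore] -/
theorem apply_incl (h : IsRegularLevel I f a) (p : RegularLevel h) : f (incl h p) = a := p.2

/-- The image of the inclusion is the level `f⁻¹(a)`. [folklore] -/
@[simp]
theorem range_incl (h : IsRegularLevel I f a) : range (incl h) = f ⁻¹' {a} := Subtype.range_val

/-- The inclusion is a topological embedding. [folklore] -/
theorem isEmbedding_incl (h : IsRegularLevel I f a) : Topology.IsEmbedding (incl h) :=
  Topology.IsEmbedding.subtypeVal

/-- A regular level of a function on a Hausdorff manifold is Hausdorff. [folklore] -/
instance instT2Space [T2Space M] (h : IsRegularLevel I f a) : T2Space (RegularLevel h) :=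
  inferInstanceAs (T2Space ↥(f ⁻¹' {a}))

/-- A regular level of a function on a second countable manifold is second countable.
[folklore] -/
instance instSecondCountableTopology [SecondCountableTopology M] (h : IsRegularLevel I f a) :
    SecondCountableTopology (RegularLevel h) :=
  inferInstanceAs (SecondCountableTopology ↥(f ⁻¹' {a}))

/-- A regular level of a function on a compact manifold is compact. [folklore] -/
instance instCompactSpace [CompactSpace M] (h : IsRegularLevel I f a) :
    CompactSpace (RegularLevel h) :=
  isCompact_iff_compactSpace.1 h.isCompact_preimage

/-- `f` is constant (`= a`) on the regular level, as a function on the level manifold.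
[folklore] -/
theorem comp_incl (h : IsRegularLevel I f a) : f ∘ incl h = fun _ => a :=
  funext fun p => p.2

variable [IsManifold I ∞ M] [SliceModel I]

/-- **The regular level is a smooth `n`-manifold, charts**: the atlas of `f⁻¹(a)` given by the
slice charts along the level with the last coordinate dropped (`SliceChartFamily.chartedSpace`
of `IsRegularLevel.sliceChartFamily`). Hirsch, *Differential Topology* (1976), Ch. 1, §3,
Thm. 3.2 with §2, p. 14 (the restricted submanifold charts form an atlas).
[cite: HirschDT1976, Ch. 1 §3, Thm. 3.2] -/
instance instChartedSpace (h : IsRegularLevel I f a) : ChartedSpace (𝔼 n) (RegularLevel h) :=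
  h.sliceChartFamily.chartedSpace

/-- **The regular level is a smooth `n`-manifold, compatibility**: the level charts form a
`C^∞` atlas (`SliceChartFamily.isManifold`); the model `𝓡 n` is boundaryless, so the level is a
manifold without boundary. Hirsch, *Differential Topology* (1976), Ch. 1, §3, Thm. 3.2.
[cite: HirschDT1976, Ch. 1 §3, Thm. 3.2] -/
instance instIsManifold (h : IsRegularLevel I f a) : IsManifold (𝓡 n) ∞ (RegularLevel h) :=
  h.sliceChartFamily.isManifold

/-- The preferred chart of the regular level at `p` is the level chart of the chosen slice
chart at `p` (definitional). [folklore] -/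
theorem chartAt_eq (h : IsRegularLevel I f a) (p : RegularLevel h) :
    chartAt (𝔼 n) p = h.sliceChartFamily.levelChart p := rfl

/-- **The inclusion of a regular level is a smooth embedding** (Hirsch, *Differential Topology*
(1976), Ch. 1, §3, Thms. 3.1–3.2: a submanifold, with its structure from the submanifold charts,
is the image of the embedding given by its inclusion).
[cite: HirschDT1976, Ch. 1 §3, Thms. 3.1–3.2] -/
theorem isSmoothEmbedding_incl (h : IsRegularLevel I f a) :
    Manifold.IsSmoothEmbedding (𝓡 n) I ∞ (incl h) :=
  h.sliceChartFamily.isSmoothEmbedding_subtype_val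

/-- The inclusion of a regular level is a smooth immersion.
[cite: HirschDT1976, Ch. 1 §3, Thms. 3.1–3.2] -/
theorem isImmersion_incl (h : IsRegularLevel I f a) : Manifold.IsImmersion (𝓡 n) I ∞ (incl h) :=
  h.sliceChartFamily.isImmersion_subtype_val

/-- The inclusion of a regular level is smooth. [cite: HirschDT1976, Ch. 1 §3, Thms. 3.1–3.2] -/
theorem contMDiff_incl (h : IsRegularLevel I f a) : ContMDiff (𝓡 n) I ∞ (incl h) :=
  h.sliceChartFamily.contMDiff_subtype_val

end RegularLevel

/-- **Regular value theorem (real-valued, interior level), existential form.** If `a` is a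
regular level of the smooth function `f : M → ℝ` lying in the interior of the `C^∞` manifold
`M` (Hausdorff, second countable, modelled on a slice model on `ℝⁿ⁺¹`), then there is a smooth
`n`-manifold `L` without boundary (Hausdorff, second countable; compact if `M` is) and a
smooth embedding `e : L → M` with image exactly `f⁻¹(a)` — namely `L = RegularLevel h`,
`e = incl`. Hirsch, *Differential Topology* (1976), Ch. 1, §3, Thms. 3.1–3.2.
[cite: HirschDT1976, Ch. 1 §3, Thms. 3.1–3.2] -/
theorem IsRegularLevel.exists_isSmoothEmbedding_range_eq [T2Space M] [SecondCountableTopology M]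
    [IsManifold I ∞ M] [SliceModel I] {f : M → ℝ} {a : ℝ} (h : IsRegularLevel I f a) :
    ∃ (L : Type u) (_ : TopologicalSpace L) (_ : T2Space L) (_ : SecondCountableTopology L)
      (_ : ChartedSpace (𝔼 n) L) (_ : IsManifold (𝓡 n) ∞ L) (e : L → M),
      Manifold.IsSmoothEmbedding (𝓡 n) I ∞ e ∧ range e = f ⁻¹' {a} ∧
        (CompactSpace M → CompactSpace L) :=
  ⟨RegularLevel h, inferInstance, inferInstance, inferInstance, inferInstance, inferInstance,
    RegularLevel.incl h, RegularLevel.isSmoothEmbedding_incl h, RegularLevel.range_incl h,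
    fun _ => inferInstance⟩

end RegularLevel

/-! ### The levels of a Morse function on a cobordism -/

section Cobordism

variable {n : ℕ} {M N : Type u} [TopologicalSpace M] [ChartedSpace (𝔼 n) M]
  [TopologicalSpace N] [ChartedSpace (𝔼 n) N]

namespace Cobordism.IsMorseFunction

/-- **A regular value in `(0, 1)` of a Morse function on a cobordism is a regular level in the
interior.** For a Morse function `f` on the cobordism `c = (W; M, N)` (`Cobordism.IsMorseFunction`:
Morse, `f = 0` on `M`, `f = 1` on `N`, values in `(0, 1)` inside; Milnor, *Lectures on the
h-cobordism theorem* (1965), Def. 3.1) and `a ∈ (0, 1)` not a critical value, the level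
`f⁻¹(a)` misses `∂W = M ⊔ N` (where `f ∈ {0, 1}`) and contains no critical point.
[cite: MilnorHCobordism1965, Def. 3.1] -/
theorem isRegularLevel {c : Cobordism n M N} {f : c.W → ℝ} (hf : c.IsMorseFunction f) {a : ℝ}
    (ha : a ∈ Ioo (0 : ℝ) 1) (hreg : ∀ z, IsMCriticalPt (𝓡∂ (n + 1)) f z → f z ≠ a) :
    IsRegularLevel (𝓡∂ (n + 1)) f a where
  contMDiff := hf.isMorse.contMDiff
  isInteriorPoint x hx := by
    by_contra hx'
    have hb : x ∈ (𝓡∂ (n + 1)).boundary c.W :=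
      ((𝓡∂ (n + 1)).isInteriorPoint_or_isBoundaryPoint x).resolve_left hx'
    rw [← c.range_inl_union_range_inr] at hb
    rcases hb with ⟨y, rfl⟩ | ⟨y, rfl⟩
    · exact ha.1.ne' (hx.symm.trans (hf.2.1 y))
    · exact ha.2.ne (hx.symm.trans (hf.2.2.1 y))
  not_isMCriticalPt x hx hcrit := hreg x hcrit hx

/-- **The regular levels of a Morse function on a cobordism are closed smooth manifolds.** For
a Morse function `f` on a cobordism `(W; M, N)` between `n`-manifolds, `n ≥ 1`, and a regular
value `a ∈ (0, 1)`, there are a compact smooth `n`-manifold `L` without boundary (Hausdorff,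
second countable) and a smooth embedding `e : L → W` with image the level `f⁻¹(a)` (namely the
subtype `f⁻¹(a)` with the structure of `Literature.Topology.FourManifolds.RegularLevel`). Milnor, *Lectures on the
h-cobordism theorem* (1965), §3 (the levels `f⁻¹(c)` of a Morse function on a cobordism, e.g.
in Def. 3.9 ff. and the proof of Thm. 3.4, are compact smooth manifolds by the regular
value theorem); Hirsch, *Differential Topology* (1976), Ch. 1, §4, Thm. 4.1. This is the form
in which `HCobordismMiddleLevel.lean` packages the middle level `f⁻¹(1/2)`.
[cite: HirschDT1976, Ch. 1 §4, Thm. 4.1] [cite: MilnorHCobordism1965, §3] -/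
theorem exists_isSmoothEmbedding_range_eq [NeZero n] {c : Cobordism n M N} {f : c.W → ℝ}
    (hf : c.IsMorseFunction f) {a : ℝ} (ha : a ∈ Ioo (0 : ℝ) 1)
    (hreg : ∀ z, IsMCriticalPt (𝓡∂ (n + 1)) f z → f z ≠ a) :
    ∃ (L : Type u) (_ : TopologicalSpace L) (_ : T2Space L) (_ : SecondCountableTopology L)
      (_ : ChartedSpace (𝔼 n) L) (_ : CompactSpace L) (_ : IsManifold (𝓡 n) ∞ L)
      (e : L → c.W), Manifold.IsSmoothEmbedding (𝓡 n) (𝓡∂ (n + 1)) ∞ e ∧ range e = f ⁻¹' {a} :=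
  ⟨RegularLevel (hf.isRegularLevel ha hreg), inferInstance, inferInstance, inferInstance,
    inferInstance, inferInstance, inferInstance, RegularLevel.incl _,
    RegularLevel.isSmoothEmbedding_incl _, RegularLevel.range_incl _⟩

end Cobordism.IsMorseFunction

end Cobordism

/-! ### The middle level of a simply connected `5`-dimensional h-cobordism -/

section MiddleLevel

variable {X₁ X₂ : Type u} [TopologicalSpace X₁] [T2Space X₁] [SecondCountableTopology X₁]
  [ChartedSpace (𝔼 4) X₁] [IsManifold (𝓡 4) ∞ X₁] [CompactSpace X₁] [SimplyConnectedSpace X₁]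
  [TopologicalSpace X₂] [T2Space X₂] [SecondCountableTopology X₂]
  [ChartedSpace (𝔼 4) X₂] [IsManifold (𝓡 4) ∞ X₂] [CompactSpace X₂]

/-- **The middle level of a simply connected h-cobordism with 2- and 3-handles only is a closed
smooth 4-manifold.** Granting rung K1 (`Literature.Topology.FourManifolds.exists_isMorseFunction_two_three_of_isHCobordism`:
Freedman–Quinn 1990, proof of Thm. 7.1D, p. 85; Milnor 1965, Thm. 4.8 and §8), h-cobordant closed
smooth 4-manifolds `X₁`, `X₂` with `X₁` simply connected bound an h-cobordism `W` carrying a Morse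
function `f` with only index-`2` critical points, all below `1/2`, and index-`3` critical points,
all above `1/2`, equinumerous; *and then* the middle level `f⁻¹(1/2)` — "the level between the 2-
and 3-handles" (Freedman–Quinn, p. 85: "Let `N` denote the level between the 2- and 3-handles"),
`M_{1/2}` (Kirby 1989, Ch. X, p. 55) — is a regular level, hence (regular value theorem,
`Cobordism.IsMorseFunction.exists_isSmoothEmbedding_range_eq`) a compact smooth 4-manifold
without boundary smoothly embedded in `W` with image `f⁻¹(1/2)`. This is the proved part of
rung K1′ (`Literature.Topology.FourManifolds.exists_middleLevel_isStabilization_of_isHCobordism`, `HCobordismMiddleLevel.lean`,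
whose remaining content is the identification of this level with `X₁ # k(S² × S²)` and
`X₂ # k(S² × S²)`) and the starting datum of Casson's middle-level constructions in Freedman's
proof (`HCobordismFreedman.lean`, rung v2).
[cite: FreedmanQuinnPMS1990, proof of Thm. 7.1D (p. 85)] [cite: Kirby1989, Ch. X, p. 55] -/
theorem IsHCobordant.exists_middleLevel_of_two_three
    (h : exists_isMorseFunction_two_three_of_isHCobordism.{u}) (hcob : IsHCobordant 4 X₁ X₂) :
    ∃ (c : Cobordism 4 X₁ X₂) (f : c.W → ℝ) (L : Type u) (_ : TopologicalSpace L) (_ : T2Space L)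
      (_ : SecondCountableTopology L) (_ : ChartedSpace (𝔼 4) L) (_ : CompactSpace L)
      (_ : IsManifold (𝓡 4) ∞ L) (e : L → c.W),
      c.IsHCobordism ∧ c.IsMorseFunction f ∧
      (∀ z, IsMCriticalPt (𝓡∂ (4 + 1)) f z →
        morseIndex (𝓡∂ (4 + 1)) f z = 2 ∧ f z < 2⁻¹ ∨
          morseIndex (𝓡∂ (4 + 1)) f z = 3 ∧ 2⁻¹ < f z) ∧
      (criticalSetOfIndex (𝓡∂ (4 + 1)) f 2).ncard =
        (criticalSetOfIndex (𝓡∂ (4 + 1)) f 3).ncard ∧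
      Manifold.IsSmoothEmbedding (𝓡 4) (𝓡∂ (4 + 1)) ∞ e ∧ range e = f ⁻¹' {2⁻¹} := by
  obtain ⟨c, hc⟩ := hcob
  obtain ⟨f, hf, hind, hcard⟩ := h X₁ X₂ c hc
  have hreg : ∀ z, IsMCriticalPt (𝓡∂ (4 + 1)) f z → f z ≠ 2⁻¹ := fun z hz hz' =>
    not_isMCriticalPt_of_apply_eq hind hz' hz
  obtain ⟨L, _, _, _, _, _, _, e, he, hrange⟩ :=
    hf.exists_isSmoothEmbedding_range_eq ⟨by norm_num, by norm_num⟩ hreg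
  exact ⟨c, f, L, ‹_›, ‹_›, ‹_›, ‹_›, ‹_›, ‹_›, e, hc, hf, hind, hcard, he, hrange⟩

end MiddleLevel

end Literature.Topology.FourManifolds
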